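import Literature.NumberTheory.IwasawaTheory.Fukuda1994Thm1RankPackageFixed
import Literature.NumberTheory.IwasawaTheory.FukudaDepthAlgebra
import Literature.NumberTheory.IwasawaTheory.FukudaGroupLayers
import Literature.NumberTheory.IwasawaTheory.ClassGroupPRankSmallRankCriterion
import Literature.NumberTheory.IwasawaTheory.ClassicalLambdaLeStableRank
import Literature.NumberTheory.IwasawaTheory.ZpExtensionLayerRamificationDichotomy
import Literature.NumberTheory.IwasawaTheory.ClassicalMuVanishesUnitNormIndexGenerated
import Literature.NumberTheory.NumberFields.AmbiguousClassNumberFormula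
import HarnessLib

/-!
# The DEPTH DOOR at `p = 2`: over a layer with `2 ∤ h(K_n)`, `ord₂ h(K_{n+1}) ≤ 1` AND `4 ∣ #Cl(K_{n+2})^{Gal(K_{n+2}/K_n)}`
# force `rank₂ Cl(K_m) ≤ 1` for every `m ≥ n`, `μ₂ = 0`, `λ₂ ≤ 1` — Chevalley's count for the cyclic QUARTIC layer `K_{n+2}/K_n`
# (two totally ramified primes, every unit of `K_n` a norm from `K_{n+2}`) instead of a unit of `K_{n+1}`

Topic `NumberTheory/IwasawaTheory` (namespace = path).  THEOREM-ONLY file (no definition, no named fact, no instance, no `sorry`), written by the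
prover seat `bsd-line-att-p3` g42 (cell `bsd-f1-sign2`, route `AlignedTransportAtTwo`; `--supports` stmt-BirchSwinnertonDyer-22298, closes nothing; no class group
is computed here).  Third file of the «depth door» (after the algebra brick `FukudaDepthAlgebra` and the package export `Fukuda1994Thm1RankPackageFixed`).

THE DOOR (`classGroupPRank_add_two_le_one_of_dvd_card_fixed`, then `…_add_le_one_…`, `classicalMuVanishes_and_classicalLambda_le_one_…`).  `κ` a `ℤ₂`-extension of
the number field `K` with Fukuda index `n₀ ≤ n` (`TotallyRamifiedFrom κ n₀`), `e_n = ord₂ h(K_n) = 0`, `e_{n+1} ≤ 1`, and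
**`4 ∣ #{c ∈ Cl(K_{n+2}) : τc = c for all τ ∈ Gal(K_{n+2}/K_n)}`**.  THEN `rank₂ Cl(K_{n+2}) ≤ 1`, hence (one-layer small-rank criterion L10 at `j = 2`:
`rank₂ Cl(K_{n+2}) < 2² − 1`) `rank₂ Cl(K_{n+k}) ≤ 1` for every `k`, `μ₂(κ) = 0` and `λ₂(κ) ≤ 1`.

CHEVALLEY CURRENCY (`four_dvd_card_fixed_layer_two`, `classGroupPRank_le_one_of_relIndex_unitsNorm_eq_one`, Fukuda index `0`): `2 ∤ h_K`, `ord₂ h(K_1) ≤ 1`, at least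
two primes of `K` ramified in `K_2` (each then with `e = 4`, `∏ e_𝔭 = 4^s`, `finprod_ramificationIdxIn_layer_eq_pow`) and `[E_K : E_K ∩ N_{K_2/K} K_2ˣ] = 1` (every unit
of `K` is a norm from the quartic layer) ⟹ `#Cl(K_2)^G · 4 = h_K · 4^s` (tree `ambiguousClassNumberFormula`, `archFactor_eq_one`), so `4 ∣ #Cl(K_2)^G` ⟹ the door.

PROOF OF THE DOOR (Washington §13.3 at finite level, in the package `Fukuda1994Thm1RankPackageFixed.exists_layer_package_fixed` with `t = 2`:
`G = Gal(H_2(K_{n+2})/K_n) = A⋊⟨g⟩`, `A = Gal(H_2/K_{n+2})` of order `2^{e_{n+2}}`, `φ` = conjugation by the totally ramified inertia generator `g`).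
(0) `e_n = 0` ⟹ `N₀ = G`, i.e. `Y₀ = A` («`Y₀ = X` when `A₀ = 0`»).  (1) Lemma 13.18: `2^{e_{n+1}} = [G₁ : N₁] = #A/ν₁Y₀ = #A/(1+φ)A ≤ 2`.
(2) The equivariant Artin export: `#ker(φ − 1) = #{a ∈ A : gag⁻¹ = a} ≥ 2^{v₂ #Cl(K_{n+2})^{σ}} ≥ 4` (`σ = g|_{K_{n+2}}` generates `Gal(K_{n+2}/K_n)`, so the
`σ`-fixed classes are the `Gal(K_{n+2}/K_n)`-fixed classes).  (3) The depth lemma (`FukudaDepth.card_quotient_map_two_le_two_of_ker`): `#A/2A ≤ 2`.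
(4) `ν₂Y₀ = 0` at the top layer, so `2^{r_{n+2}} = [A : N₂P₂ ∩ A] = #A/2A ≤ 2`.

WHY IT IS A `p = 2` PHENOMENON.  `X = Λ/J` is cyclic as soon as `e_n = 0`, `e_{n+1} = 1` (`X/𝔪X ↞ X/(2+T)X = 𝔽₂`); `v₂(j(−2)) = 1` leaves `j ≡ T²·u` possible
(`J = (T² + 2)`: `e_1 = 1`, `rank 2` for ever), and Chevalley's `J(0) ⊆ 4ℤ₂` excludes it.  At odd `p`, `e_{n+1} = 1` alone gives `rank ≤ 1` (door L10, `j = 1`).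
USE (cell bsd-f1-sign2, crux C2; complex cubic `F = ℚ(β)`, `h_F` odd, `Δ_W ≡ 5 (8)`, `2 = 𝔭₁𝔭₂`): `E_F = ⟨−1, ε⟩`; the door's input is `ord₂ h(F_1) ≤ 1` and two norm
identities `N(α) = −1`, `N(β′) = ε` from `F_2 = F(θ)`, `θ⁴ − 4θ² + 2 = 0` — it is aimed at the `u1/u7` seeds (`σ₁(ε) ≡ ±1 (16)`) where the layer-one unit door
(`ClassicalMuVanishesLayerOneUnitCertificateTwo`) is dead.  HONEST SCOPE: classical (Washington §13.3 + Chevalley + equivariant Artin reciprocity); nothing specific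
to any summit; BSD is not advanced by this file.  Not found in print in this form (corpus hybrid/vsearch: Lang Ch. 13 §4, Washington §13.3; galaxy: noise) —
ingredients cited at each use (D-0014).

References: [Washington1997] L. Washington, *Introduction to Cyclotomic Fields*, 2nd ed., §13.1 Prop. 13.2, §13.3 Lemmas 13.15, 13.18, Prop. 13.22–13.23;
[Fukuda1994] T. Fukuda, Proc. Japan Acad. 70 A (1994), Thm. 1, p. 264; [Lang1990] S. Lang, *Cyclotomic Fields I and II*, Ch. 13 §4 Lemma 4.1 (PDF pp. 203–204);
[NeukirchANT1999] Ch. I §9 Prop. (9.6), Ch. IV §6, Ch. VI §7 Thm. (7.1); [Gras2003] II.6.2.3, IV.4.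
-/

set_option autoImplicit false

noncomputable section

open Subgroup Finset
open scoped NumberField IsMulCommutative
open NumberField IsDedekindDomain Field IntermediateField

namespace Literature.NumberTheory.IwasawaTheory

open Literature.NumberTheory.EllipticCurves Literature.NumberTheory.NumberFields

/-! ## §1 The group-theoretic step inside an abstract package (`t = 2`) -/

section Abstract

/-- **The depth door inside an abstract Fukuda package with `t = 2`, `p = 2`.**  `G` finite, `A ⊴ G` abelian of `2`-power order and index `4` with
`G = A⟨g⟩`, `⟨g⟩ ∩ A = 1`, `𝓘` the inertia family (`I ∩ A = 1`, `I = 1 ∨ IA = G`, `⟨g⟩ ∈ 𝓘`).  If `N₀ = G'·⟨I⟩ = G` (`e_n = 0`), the layer `G₁ ⊇ A` of index `2` has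
`[G₁ : N₁] ≤ 2` (`e_{n+1} ≤ 1`) and `#{a ∈ A : gag⁻¹ = a} ≥ 4`, then the top layer `G₂ = A` has `[G₂ : N₂·P₂] ≤ 2` (`rank₂ ≤ 1`): Washington's `Y₀ = A`,
`#A/(1+φ)A = [G₁:N₁]`, `#A^{φ} ≥ 4`, the depth lemma, `ν₂Y₀ = 0`. [cite: Washington1997, §13.3 Lemmas 13.15, 13.18 and Prop. 13.22] [cite: Fukuda1994, Thm. 1 (proof, p. 264)] -/
private theorem relIndex_layer_two_le_two {G : Type*} [Group G] [Finite G] (A : Subgroup G) [A.Normal] [IsMulCommutative A]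
    {g : G} {𝓘 : Set (Subgroup G)}
    (hgA : Subgroup.zpowers g ⊓ A = ⊥) (hgen : A ⊔ Subgroup.zpowers g = ⊤) (hind : A.index = 2 ^ 2)
    (h𝓘 : ∀ I ∈ 𝓘, I ⊓ A = ⊥ ∧ (I = ⊥ ∨ I ⊔ A = ⊤)) (hg𝓘 : Subgroup.zpowers g ∈ 𝓘)
    (hAcard : ∃ a : ℕ, Nat.card A = 2 ^ a)
    (he₀ : ⁅(⊤ : Subgroup G), ⊤⁆ ⊔ ⨆ I ∈ 𝓘, I = ⊤)
    {G₁ : Subgroup G} (hAG₁ : A ≤ G₁) (hG₁ : G₁.index = 2 ^ 1)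
    (he₁ : (⁅G₁, G₁⁆ ⊔ ⨆ I ∈ 𝓘, I ⊓ G₁).relIndex G₁ ≤ 2)
    {G₂ : Subgroup G} (hAG₂ : A ≤ G₂) (hG₂ : G₂.index = 2 ^ 2)
    (hfix : 4 ≤ Nat.card {a : A // g * (a : G) * g⁻¹ = a}) :
    ((⁅G₂, G₂⁆ ⊔ ⨆ I ∈ 𝓘, I ⊓ G₂) ⊔ Subgroup.closure ((fun x : G => x ^ 2) '' (G₂ : Set G))).relIndex G₂ ≤ 2 := by
  classical
  haveI : Fact (Nat.Prime 2) := ⟨Nat.prime_two⟩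
  set Y : Submodule ℤ (Additive A) := FukudaGroup.subOf A (⁅(⊤ : Subgroup G), ⊤⁆ ⊔ ⨆ I ∈ 𝓘, I) with hY
  set φ : Module.End ℤ (Additive A) := FukudaGroup.conjEnd A g with hφ
  set P : Submodule ℤ (Additive A) :=
    (⊤ : Submodule ℤ (Additive A)).map (((2 : ℕ) : ℤ) • (1 : Module.End ℤ (Additive A))) with hP
  have hφ4 : φ ^ 2 ^ 2 = 1 := FukudaGroup.conjEnd_pow_index_eq_one (p := 2) hgA hgen hind
  have hAA : Nat.card (Additive A) = Nat.card A := rfl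
  -- (0) `Y = ⊤`
  have hYtop : Y = ⊤ := by
    rw [eq_top_iff]
    intro x _
    show ((Additive.toMul x : A) : G) ∈ ⁅(⊤ : Subgroup G), ⊤⁆ ⊔ ⨆ I ∈ 𝓘, I
    rw [he₀]; exact Subgroup.mem_top _
  -- (1) `#(M/(1+φ)M) ≤ 2`
  have h1 : Nat.card (Additive A ⧸ (⊤ : Submodule ℤ (Additive A)).map (1 + φ)) ≤ 2 := by
    have hmul := FukudaGroup.relIndex_commutator_sup_layer_mul_card (p := 2) hgA hgen hind h𝓘 hg𝓘
      (by norm_num : 1 ≤ 2) hAG₁ hG₁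
    have hν : (∑ i ∈ range (2 ^ 1), FukudaGroup.conjEnd A g ^ i) = 1 + φ := by
      rw [hφ, pow_one, Finset.sum_range_succ, Finset.sum_range_one, pow_zero, pow_one]
    rw [hν, ← hY, hYtop] at hmul
    have hcard := Submodule.card_eq_card_quotient_mul_card ((⊤ : Submodule ℤ (Additive A)).map (1 + φ))
    rw [hAA, ← hmul, mul_comm] at hcard
    have hq : Nat.card (Additive A ⧸ (⊤ : Submodule ℤ (Additive A)).map (1 + φ)) =
        (⁅G₁, G₁⁆ ⊔ ⨆ I ∈ 𝓘, I ⊓ G₁).relIndex G₁ :=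
      Nat.eq_of_mul_eq_mul_left Nat.card_pos hcard.symm
    rw [hq]; exact he₁
  -- (2) fixed points
  have hconj : ∀ x : Additive A, ((Additive.toMul (φ x) : A) : G) = g * ((Additive.toMul x : A) : G) * g⁻¹ :=
    fun _ => rfl
  have hiff : ∀ x : Additive A, x ∈ LinearMap.ker (φ - 1) ↔
      g * ((Additive.toMul x : A) : G) * g⁻¹ = ((Additive.toMul x : A) : G) := by
    intro x
    rw [LinearMap.mem_ker, LinearMap.sub_apply, Module.End.one_apply, sub_eq_zero, ← hconj]
    constructor
    · intro h; rw [h]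
    · intro h; exact Additive.toMul.injective (Subtype.ext h)
  have h2 : 4 ≤ Nat.card (LinearMap.ker (φ - 1)) := by
    have e : LinearMap.ker (φ - 1) ≃ {a : A // g * (a : G) * g⁻¹ = a} :=
      { toFun := fun x => ⟨Additive.toMul (x : Additive A), (hiff x.1).mp x.2⟩
        invFun := fun a => ⟨Additive.ofMul a.1, (hiff _).mpr a.2⟩
        left_inv := fun _ => rfl
        right_inv := fun _ => rfl }
    rw [Nat.card_congr e]; exact hfix
  -- (3) depth lemma
  have hM : ∃ a : ℕ, Nat.card (Additive A) = 2 ^ a := by rw [hAA]; exact hAcard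
  have h3 := FukudaDepth.card_quotient_map_two_le_two_of_ker hM φ hφ4 h1 h2
  -- (4) the top layer: `ν₂ Y = 0`, `[G₂ : N₂P₂] = #(M/2M)`
  have hmul₂ := FukudaGroup.relIndex_commutator_sup_layer_pow_mul_card (p := 2) hgA hgen hind h𝓘 hg𝓘 le_rfl hAG₂ hG₂
  have hν₂ : Y.map (∑ i ∈ range (2 ^ 2), FukudaGroup.conjEnd A g ^ i) = ⊥ :=
    FukudaGroup.map_subOf_commutator_sup_index_eq_bot (p := 2) hgA hgen hind h𝓘 hg𝓘
  rw [← hY, hν₂, bot_sup_eq] at hmul₂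
  have hP2 : P = (⊤ : Submodule ℤ (Additive A)).map ((2 : ℤ) • (1 : Module.End ℤ (Additive A))) := by
    rw [hP, Nat.cast_ofNat]
  rw [← hP, hP2] at hmul₂
  have hcard := Submodule.card_eq_card_quotient_mul_card
    ((⊤ : Submodule ℤ (Additive A)).map ((2 : ℤ) • (1 : Module.End ℤ (Additive A))))
  rw [hAA, ← hmul₂, mul_comm] at hcard
  have hq := Nat.eq_of_mul_eq_mul_left Nat.card_pos hcard.symm
  -- hq : #(M/2M) = relIndex
  rw [← hq]; exact h3

variable {F L : Type*} [Field F] [Field L] [NumberField L] [Algebra F L] [Finite (L ≃ₐ[F] L)] in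
/-- If `σ` satisfies a condition `cond` and every automorphism satisfying `cond` is a power of `σ`, the classes fixed by all `τ` with `cond τ` are exactly the
classes fixed by `σ` (in a finite group `zpowers σ = powers σ`; `AmbiguousClass.mulEquiv_intAut_mul`). [folklore] -/
private theorem card_fixed_eq_card_fixed_of_generator (cond : (L ≃ₐ[F] L) → Prop) (σ : L ≃ₐ[F] L) (hσ : cond σ)
    (hgen : ∀ τ : L ≃ₐ[F] L, cond τ → τ ∈ Subgroup.zpowers σ) :
    Nat.card {c : ClassGroup (𝓞 L) // ∀ τ : L ≃ₐ[F] L, cond τ → ClassGroup.mulEquiv (AmbiguousClass.intAut τ) c = c} =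
      Nat.card {c : ClassGroup (𝓞 L) // ClassGroup.mulEquiv (AmbiguousClass.intAut σ) c = c} := by
  refine Nat.card_congr (Equiv.subtypeEquivRight fun c => ⟨fun h => h σ hσ, fun h τ hτ => ?_⟩)
  obtain ⟨k, rfl⟩ := (Submonoid.mem_powers_iff _ _).mp (mem_powers_iff_mem_zpowers.mpr (hgen τ hτ))
  clear hτ
  induction k with
  | zero => rw [pow_zero, AmbiguousClass.mulEquiv_intAut_one, MulEquiv.refl_apply]
  | succ k ih => rw [pow_succ, AmbiguousClass.mulEquiv_intAut_mul, MulEquiv.trans_apply, h, ih]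

end Abstract

/-! ## §2 The door inside the package of `K_n ⊆ K_{n+2} ⊆ H_2(K_{n+2})` -/

section Door

variable {K : Type} [Field K] [NumberField K]

/-- ★★ **THE DEPTH DOOR (one layer).**  `κ` a `ℤ₂`-extension of the number field `K` with Fukuda index `n₀ ≤ n`; if `ord₂ h(K_n) = 0`, `ord₂ h(K_{n+1}) ≤ 1` and
**`4` divides the number of classes of `K_{n+2}` fixed by `Gal(K_{n+2}/K_n)`** (the `K`-automorphisms of `K_{n+2}` fixing `K_n` pointwise), then
**`rank₂ Cl(K_{n+2}) ≤ 1`**.  (Package `exists_layer_package_fixed` at `t = 2`; §1.) [cite: Washington1997, §13.3 Lemmas 13.15, 13.18 and Prop. 13.22]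
[cite: Fukuda1994, Thm. 1 (proof, p. 264)] [cite: Lang1990, Ch. 13 §4 Lemma 4.1] [cite: NeukirchANT1999, Ch. IV §6 and Ch. VI §7 Thm. (7.1)] -/
theorem classGroupPRank_add_two_le_one_of_dvd_card_fixed (κ : ZpExtension K 2) {n₀ n : ℕ} (hκ : TotallyRamifiedFrom κ n₀) (hn : n₀ ≤ n)
    (he0 : classNumberPExp κ n = 0) (he1 : classNumberPExp κ (n + 1) ≤ 1)
    (hfix : 4 ∣ Nat.card {c : ClassGroup (𝓞 (κ.layer (n + 2))) //
        ∀ τ : (κ.layer (n + 2)) ≃ₐ[K] (κ.layer (n + 2)),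
          (∀ y : κ.layer (n + 2), ((y : κ.layer (n + 2)) : AlgebraicClosure K) ∈ κ.layer n → τ y = y) →
            ClassGroup.mulEquiv (AmbiguousClass.intAut τ) c = c}) :
    classGroupPRank κ (n + 2) ≤ 1 := by
  classical
  haveI : FiniteDimensional K (κ.layer (n + 2)) := κ.finiteDimensional_layer_holds (n + 2)
  haveI : NumberField (κ.layer (n + 2)) := NumberField.of_module_finite K _
  haveI : Finite ((κ.layer (n + 2)) ≃ₐ[K] (κ.layer (n + 2))) := inferInstance
  obtain ⟨G, _instG, _instF, A, hAn, _instC, g, 𝓘, hgA, hgen, hind, h𝓘, hg𝓘, hAcard, ⟨σ, hσfix, hσgen, hcount⟩, hlayer⟩ :=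
    exists_layer_package_fixed κ hκ hn 2 (by norm_num)
  obtain ⟨G₀, hAG₀, hG₀, he₀, -⟩ := hlayer 0 (by norm_num)
  obtain ⟨G₁, hAG₁, hG₁, he₁, -⟩ := hlayer 1 (by norm_num)
  obtain ⟨G₂, hAG₂, hG₂, -, hr₂⟩ := hlayer 2 le_rfl
  -- (0) `N₀ = G`
  have hG₀top : G₀ = ⊤ := by rwa [pow_zero, Subgroup.index_eq_one] at hG₀
  subst hG₀top
  rw [Nat.add_zero, he0, pow_zero, Subgroup.relIndex_eq_one] at he₀
  have hN₀ : ⁅(⊤ : Subgroup G), ⊤⁆ ⊔ ⨆ I ∈ 𝓘, I = ⊤ := by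
    rw [eq_top_iff]
    refine he₀.trans (le_of_eq ?_)
    simp only [inf_top_eq]
  -- (1) `[G₁ : N₁] ≤ 2`
  have he₁' : (⁅G₁, G₁⁆ ⊔ ⨆ I ∈ 𝓘, I ⊓ G₁).relIndex G₁ ≤ 2 := by
    rw [he₁]
    calc 2 ^ classNumberPExp κ (n + 1) ≤ 2 ^ 1 := Nat.pow_le_pow_right (by norm_num) he1
      _ = 2 := pow_one 2
  -- (2) the fixed points: `4 ≤ #{a : g a g⁻¹ = a}`
  have hfixσ : 4 ∣ Nat.card {c : ClassGroup (𝓞 (κ.layer (n + 2))) // ClassGroup.mulEquiv (AmbiguousClass.intAut σ) c = c} := by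
    rwa [card_fixed_eq_card_fixed_of_generator
      (fun τ : (κ.layer (n + 2)) ≃ₐ[K] (κ.layer (n + 2)) =>
        ∀ y : κ.layer (n + 2), ((y : κ.layer (n + 2)) : AlgebraicClosure K) ∈ κ.layer n → τ y = y) σ hσfix hσgen] at hfix
  have hfixA : 4 ≤ Nat.card {a : A // g * (a : G) * g⁻¹ = a} := by
    have hne : Nat.card {c : ClassGroup (𝓞 (κ.layer (n + 2))) // ClassGroup.mulEquiv (AmbiguousClass.intAut σ) c = c} ≠ 0 := by
      haveI : Nonempty {c : ClassGroup (𝓞 (κ.layer (n + 2))) // ClassGroup.mulEquiv (AmbiguousClass.intAut σ) c = c} :=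
        ⟨⟨1, map_one _⟩⟩
      exact Nat.card_pos.ne'
    have hv : 2 ≤ padicValNat 2
        (Nat.card {c : ClassGroup (𝓞 (κ.layer (n + 2))) // ClassGroup.mulEquiv (AmbiguousClass.intAut σ) c = c}) :=
      (padicValNat_dvd_iff_le hne).mp (by rw [show (2 : ℕ) ^ 2 = 4 by norm_num]; exact hfixσ)
    calc 4 = 2 ^ 2 := by norm_num
      _ ≤ 2 ^ padicValNat 2 (Nat.card {c : ClassGroup (𝓞 (κ.layer (n + 2))) //
            ClassGroup.mulEquiv (AmbiguousClass.intAut σ) c = c}) := Nat.pow_le_pow_right (by norm_num) hv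
      _ ≤ _ := hcount
  -- (3)+(4) the abstract step, then `2^{r_{n+2}} ≤ 2`
  have hA2 : ∃ a : ℕ, Nat.card A = 2 ^ a := ⟨_, hAcard⟩
  have h := relIndex_layer_two_le_two A hgA hgen hind h𝓘 hg𝓘 hA2 hN₀ hAG₁ hG₁ he₁' hAG₂ hG₂ hfixA
  rw [hr₂] at h
  have h1 : 2 ^ classGroupPRank κ (n + 2) ≤ 2 ^ 1 := by rw [pow_one]; exact h
  exact (Nat.pow_le_pow_iff_right (by norm_num)).mp h1

/-- ★★ **THE DEPTH DOOR (every layer).**  Under the hypotheses of `classGroupPRank_add_two_le_one_of_dvd_card_fixed`: **`rank₂ Cl(K_{n+k}) ≤ 1` for every `k`**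
(`rank₂ Cl(K_{n+2}) ≤ 1 < 2² − 1` is the one-layer small-rank criterion L10 at `j = 2`, tree `classGroupPRank_le_of_lt_pow_sub_one`).
[cite: Washington1997, §13.3 Prop. 13.22–13.23] [cite: Fukuda1994, Thm. 1 (2), p. 264] -/
theorem classGroupPRank_add_le_one_of_dvd_card_fixed (κ : ZpExtension K 2) {n₀ n : ℕ} (hκ : TotallyRamifiedFrom κ n₀) (hn : n₀ ≤ n)
    (he0 : classNumberPExp κ n = 0) (he1 : classNumberPExp κ (n + 1) ≤ 1)
    (hfix : 4 ∣ Nat.card {c : ClassGroup (𝓞 (κ.layer (n + 2))) //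
        ∀ τ : (κ.layer (n + 2)) ≃ₐ[K] (κ.layer (n + 2)),
          (∀ y : κ.layer (n + 2), ((y : κ.layer (n + 2)) : AlgebraicClosure K) ∈ κ.layer n → τ y = y) →
            ClassGroup.mulEquiv (AmbiguousClass.intAut τ) c = c}) (k : ℕ) :
    classGroupPRank κ (n + k) ≤ 1 := by
  have h2 := classGroupPRank_add_two_le_one_of_dvd_card_fixed κ hκ hn he0 he1 hfix
  have hsmall : classGroupPRank κ (n + 2) < 2 ^ 2 - 1 := by
    have : (2 : ℕ) ^ 2 - 1 = 3 := by norm_num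
    omega
  exact (classGroupPRank_le_of_lt_pow_sub_one κ hκ hn hsmall k).trans h2

/-- ★★ **THE DEPTH DOOR: `μ₂ = 0` and `λ₂ ≤ 1`.**  Under the hypotheses of `classGroupPRank_add_two_le_one_of_dvd_card_fixed` the `2`-ranks are bounded by `1` from
`K_n` on, so Iwasawa's `μ`-invariant of `κ` vanishes (growth form) and `λ(κ) ≤ 1` (tree `classicalLambda_le_of_forall_classGroupPRank_le`).
[cite: Washington1997, §13.3 Prop. 13.23 and Thm. 13.13] [cite: Fukuda1994, Thm. 1 (2), p. 264] -/
theorem classicalMuVanishes_and_classicalLambda_le_one_of_dvd_card_fixed (κ : ZpExtension K 2) {n₀ n : ℕ}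
    (hκ : TotallyRamifiedFrom κ n₀) (hn : n₀ ≤ n)
    (he0 : classNumberPExp κ n = 0) (he1 : classNumberPExp κ (n + 1) ≤ 1)
    (hfix : 4 ∣ Nat.card {c : ClassGroup (𝓞 (κ.layer (n + 2))) //
        ∀ τ : (κ.layer (n + 2)) ≃ₐ[K] (κ.layer (n + 2)),
          (∀ y : κ.layer (n + 2), ((y : κ.layer (n + 2)) : AlgebraicClosure K) ∈ κ.layer n → τ y = y) →
            ClassGroup.mulEquiv (AmbiguousClass.intAut τ) c = c}) :
    ClassicalMuVanishes κ ∧ classicalLambda κ ≤ 1 :=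
  classicalLambda_le_of_forall_classGroupPRank_le κ hκ hn (B := 1) fun m hm => by
    obtain ⟨k, rfl⟩ := Nat.exists_eq_add_of_le hm
    exact classGroupPRank_add_le_one_of_dvd_card_fixed κ hκ hn he0 he1 hfix k

end Door

/-! ## §3 Chevalley currency at Fukuda index `0`: two totally ramified primes and `E_K ⊆ N_{K_2/K} K_2ˣ` -/

section Chevalley

open Literature.NumberTheory.GaloisRepresentations Literature.NumberTheory.NumberFields.AmbiguousClass
  Literature.NumberTheory.GaloisRepresentations.Herbrand Literature.NumberTheory.GaloisRepresentations.MinkowskiUnit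
  Literature.NumberTheory.GaloisRepresentations.CyclicNormIndex

variable {K : Type} [Field K] [NumberField K] {p : ℕ} [hp : Fact p.Prime]

/-- Every `K`-automorphism of a layer fixes `K_0 = K` pointwise (`κ.layer 0 = ⊥`). [folklore] -/
private theorem forall_apply_eq_of_mem_layer_zero (κ : ZpExtension K p) (m : ℕ) (τ : (κ.layer m) ≃ₐ[K] (κ.layer m))
    (y : κ.layer m) (hy : ((y : κ.layer m) : AlgebraicClosure K) ∈ κ.layer 0) : τ y = y := by
  rw [κ.layer_zero, IntermediateField.mem_bot] at hy
  obtain ⟨k, hk⟩ := hy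
  have : y = algebraMap K (κ.layer m) k := Subtype.ext hk.symm
  rw [this, AlgEquiv.commutes]


/-- **In a layer `K_m/K` of a `ℤ_p`-extension with Fukuda index `0` every ramified prime of `K` is totally ramified: `e_v ≠ 1 ⟹ e_v = p^m`**
(`#I(Q) = e`, Mathlib `Ideal.card_inertia_eq_ramificationIdxIn`, and the tree's inertia dichotomy `ZpExtension.inertia_layer_eq_bot_or_forall_mem`).
[cite: Washington1997, §13.1 Prop. 13.2 and §13.3 Lemma 13.15 (standing assumption)] [cite: NeukirchANT1999, Ch. I §9 Prop. (9.6)] -/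
theorem ramificationIdxIn_layer_eq_pow_of_ne_one (κ : ZpExtension K p) (hκ : TotallyRamifiedFrom κ 0) (m : ℕ)
    [NumberField (κ.layer m)] {v : HeightOneSpectrum (𝓞 K)}
    (hv : v.asIdeal.ramificationIdxIn (𝓞 (κ.layer m)) ≠ 1) :
    v.asIdeal.ramificationIdxIn (𝓞 (κ.layer m)) = p ^ m := by
  classical
  haveI : FiniteDimensional K (κ.layer m) := κ.finiteDimensional_layer_holds m
  haveI : IsGalois K (κ.layer m) := κ.isGalois_layer_holds m
  haveI := v.isMaximal
  obtain ⟨Q, hQmax, hQv⟩ := Ideal.exists_maximal_ideal_liesOver_of_isIntegral (S := 𝓞 (κ.layer m)) v.asIdeal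
  haveI := hQmax
  haveI := hQv
  have hcard := Ideal.card_inertia_eq_ramificationIdxIn (G := (κ.layer m) ≃ₐ[K] (κ.layer m)) v.asIdeal Q
  rcases κ.inertia_layer_eq_bot_or_forall_mem hκ le_rfl (Nat.zero_le m) Q with h | h
  · rw [h, Subgroup.card_bot] at hcard
    exact absurd hcard.symm hv
  · have htop : Q.inertia ((κ.layer m) ≃ₐ[K] (κ.layer m)) = ⊤ := by
      rw [eq_top_iff]
      intro g _
      exact h g fun x hx => forall_apply_eq_of_mem_layer_zero κ m g x hx
    rw [htop, Subgroup.card_top, IsGalois.card_aut_eq_finrank, κ.finrank_layer_holds m] at hcard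
    exact hcard.symm


/-- **`∏_𝔭 e_𝔭(K_m/K) = (p^m)^t`**, `t` the number of primes of `K` ramified in the layer `K_m` of a `ℤ_p`-extension with Fukuda index `0`.
[cite: Lang1990, Ch. 13 §4, proof of Lemma 4.2 (PDF p. 204)] [cite: Washington1997, §13.1 Prop. 13.2] -/
theorem finprod_ramificationIdxIn_layer_eq_pow (κ : ZpExtension K p) (hκ : TotallyRamifiedFrom κ 0) (m : ℕ)
    [NumberField (κ.layer m)] :
    (∏ᶠ v : HeightOneSpectrum (𝓞 K), v.asIdeal.ramificationIdxIn (𝓞 (κ.layer m))) =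
      (p ^ m) ^ {v : HeightOneSpectrum (𝓞 K) | v.asIdeal.ramificationIdxIn (𝓞 (κ.layer m)) ≠ 1}.ncard := by
  classical
  haveI : FiniteDimensional K (κ.layer m) := κ.finiteDimensional_layer_holds m
  haveI : IsGalois K (κ.layer m) := κ.isGalois_layer_holds m
  have hfin := AmbiguousIdeal.finite_setOf_ramificationIdxIn_ne_one (K := K) (L := κ.layer m)
  have hsub : Function.mulSupport
      (fun v : HeightOneSpectrum (𝓞 K) => v.asIdeal.ramificationIdxIn (𝓞 (κ.layer m))) ⊆ ↑hfin.toFinset :=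
    fun v hv => by rw [Set.Finite.coe_toFinset]; exact hv
  rw [finprod_eq_prod_of_mulSupport_subset _ hsub, Set.ncard_eq_toFinset_card _ hfin, ← Finset.prod_const]
  refine Finset.prod_congr rfl fun v hv => ramificationIdxIn_layer_eq_pow_of_ne_one κ hκ m ?_
  exact (Set.Finite.mem_toFinset hfin).mp hv


/-- **Chevalley's count for the quartic layer `K_2/K` of a `ℤ₂`-extension with Fukuda index `0`**: if at least two primes of `K` ramify in `K_2` and every unit of
`K` is a norm from `K_2` (`[E_K : E_K ∩ N_{K_2/K} K_2ˣ] = 1` inside `K_2ˣ`), then **`4 ∣ #Cl(K_2)^{Gal(K_2/K)}`**: `#Cl(K_2)^G · [K_2:K] · [E_K : E_K ∩ N] = h_K · ∏ e_𝔭 · e_∞`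
(`ambiguousClassNumberFormula`) with `[K_2 : K] = 4`, `∏ e_𝔭 = 4^s` (`s ≥ 2`), `e_∞ = 1` (the layers are unramified at infinity). [cite: Lang1990, Ch. 13 §4, Lemma 4.1 (PDF pp. 203–204)]
[cite: Gras2003, II.6.2.3] [cite: Washington1997, §13.1 Prop. 13.2] -/
theorem four_dvd_card_fixed_layer_two (κ : ZpExtension K 2) (hκ : TotallyRamifiedFrom κ 0)
    [NumberField (κ.layer 2)]
    (hs : 2 ≤ {v : HeightOneSpectrum (𝓞 K) | v.asIdeal.ramificationIdxIn (𝓞 (κ.layer 2)) ≠ 1}.ncard)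
    (hidx : (unitsE (κ.layer 2) ⊓ (⊤ : Subgroup (κ.layer 2)ˣ).map
        (Herbrand.norm ((κ.layer 2) ≃ₐ[K] (κ.layer 2)))).relIndex
        (unitsE (κ.layer 2) ⊓ (unitsIncl K (κ.layer 2)).range) = 1) :
    4 ∣ Nat.card {c : ClassGroup (𝓞 (κ.layer 2)) //
      ∀ τ : (κ.layer 2) ≃ₐ[K] (κ.layer 2), ClassGroup.mulEquiv (intAut τ) c = c} := by
  classical
  haveI : FiniteDimensional K (κ.layer 2) := κ.finiteDimensional_layer_holds 2
  haveI : IsGalois K (κ.layer 2) := κ.isGalois_layer_holds 2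
  haveI : IsUnramifiedAtInfinitePlaces K (κ.layer 2) := κ.isUnramifiedAtInfinitePlaces_layer 2
  -- `Gal(K_2/K)` is cyclic
  obtain ⟨ψ, -, hker, -⟩ := κ.exists_cyclicCharacter_layer 2
  haveI : IsCyclic ((κ.layer 2) ≃ₐ[K] (κ.layer 2)) := isCyclic_of_cyclicLayer ψ (κ.layer 2) hker
  obtain ⟨σ, hσ⟩ := IsCyclic.exists_generator (α := (κ.layer 2) ≃ₐ[K] (κ.layer 2))
  have h := ambiguousClassNumberFormula hσ
  rw [hidx, mul_one, κ.finrank_layer_holds 2, archFactor_eq_one, mul_one,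
    finprod_ramificationIdxIn_layer_eq_pow κ hκ 2] at h
  -- `#fix · 4 = h_K · 4^s`, `s ≥ 2`
  set s := {v : HeightOneSpectrum (𝓞 K) | v.asIdeal.ramificationIdxIn (𝓞 (κ.layer 2)) ≠ 1}.ncard with hs_def
  obtain ⟨s', hs'⟩ := Nat.exists_eq_add_of_le hs
  rw [hs', show (2 : ℕ) ^ 2 = 4 by norm_num, pow_add, show (4 : ℕ) ^ 2 = 4 * 4 by norm_num] at h
  -- h : #fix * 4 = classNumber K * (4 * 4 * 4 ^ s')
  refine ⟨classNumber K * 4 ^ s', ?_⟩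
  have h4 : (0 : ℕ) < 4 := by norm_num
  apply Nat.eq_of_mul_eq_mul_right h4
  rw [h]; ring


/-- `e_0 = 0` when `p ∤ h_K` (dictionary `classNumberPExp_zero_eq_padicValNat_classNumber`). [folklore] -/
private theorem classNumberPExp_zero_eq_zero (κ : ZpExtension K p) (hK : ¬ p ∣ classNumber K) : classNumberPExp κ 0 = 0 := by
  rw [classNumberPExp_zero_eq_padicValNat_classNumber, padicValNat.eq_zero_of_not_dvd hK]

/-- ★★★ **THE DEPTH DOOR IN CHEVALLEY'S CURRENCY (Fukuda index `0`).**  `κ` a `ℤ₂`-extension of the number field `K`, totally ramified at every ramified prime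
from `K` itself (`TotallyRamifiedFrom κ 0`), with `2 ∤ h_K`, `ord₂ h(K_1) ≤ 1`, at least two primes of `K` ramified in `K_2`, and `[E_K : E_K ∩ N_{K_2/K} K_2ˣ] = 1`
(every unit of `K` is a norm from the quartic layer).  THEN **`rank₂ Cl(K_m) ≤ 1` for every `m`, `μ₂(κ) = 0` and `λ₂(κ) ≤ 1`.**
(USE, cell bsd-f1-sign2: `K = F` a complex cubic field with `h_F` odd and `2 = 𝔭₁𝔭₂`, `κ` cyclotomic; `E_F = ⟨−1, ε_F⟩`, so the norm hypothesis is two norm identities in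
`F_2 = F(θ)`, `θ⁴ − 4θ² + 2 = 0`.) [cite: Washington1997, §13.3 Prop. 13.22–13.23] [cite: Lang1990, Ch. 13 §4, Lemma 4.1 (PDF pp. 203–204)] [cite: Fukuda1994, Thm. 1, p. 264]
[cite: NeukirchANT1999, Ch. IV §6 and Ch. VI §7 Thm. (7.1)] -/
theorem classGroupPRank_le_one_of_relIndex_unitsNorm_eq_one (κ : ZpExtension K 2) (hκ : TotallyRamifiedFrom κ 0)
    (hK : ¬ 2 ∣ classNumber K) (he1 : classNumberPExp κ 1 ≤ 1) [NumberField (κ.layer 2)]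
    (hs : 2 ≤ {v : HeightOneSpectrum (𝓞 K) | v.asIdeal.ramificationIdxIn (𝓞 (κ.layer 2)) ≠ 1}.ncard)
    (hidx : (unitsE (κ.layer 2) ⊓ (⊤ : Subgroup (κ.layer 2)ˣ).map
        (Herbrand.norm ((κ.layer 2) ≃ₐ[K] (κ.layer 2)))).relIndex
        (unitsE (κ.layer 2) ⊓ (unitsIncl K (κ.layer 2)).range) = 1) :
    (∀ m, classGroupPRank κ m ≤ 1) ∧ ClassicalMuVanishes κ ∧ classicalLambda κ ≤ 1 := by
  have he0 : classNumberPExp κ 0 = 0 := classNumberPExp_zero_eq_zero κ hK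
  have h4 := four_dvd_card_fixed_layer_two κ hκ hs hidx
  -- the `Gal(K_2/K)`-fixed classes are the classes fixed by the automorphisms fixing `K_0 = K`
  have hfix : 4 ∣ Nat.card {c : ClassGroup (𝓞 (κ.layer (0 + 2))) //
      ∀ τ : (κ.layer (0 + 2)) ≃ₐ[K] (κ.layer (0 + 2)),
        (∀ y : κ.layer (0 + 2), ((y : κ.layer (0 + 2)) : AlgebraicClosure K) ∈ κ.layer 0 → τ y = y) →
          ClassGroup.mulEquiv (AmbiguousClass.intAut τ) c = c} := by
    have hcard : Nat.card {c : ClassGroup (𝓞 (κ.layer 2)) //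
        ∀ τ : (κ.layer 2) ≃ₐ[K] (κ.layer 2),
          (∀ y : κ.layer 2, ((y : κ.layer 2) : AlgebraicClosure K) ∈ κ.layer 0 → τ y = y) →
            ClassGroup.mulEquiv (AmbiguousClass.intAut τ) c = c} =
        Nat.card {c : ClassGroup (𝓞 (κ.layer 2)) //
          ∀ τ : (κ.layer 2) ≃ₐ[K] (κ.layer 2), ClassGroup.mulEquiv (AmbiguousClass.intAut τ) c = c} :=
      Nat.card_congr (Equiv.subtypeEquivRight fun c =>
        ⟨fun h τ => h τ fun y hy => forall_apply_eq_of_mem_layer_zero κ 2 τ y hy, fun h τ _ => h τ⟩)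
    have h4' := h4
    rw [← hcard] at h4'
    exact h4'
  have hrank : ∀ m, classGroupPRank κ m ≤ 1 := fun m => by
    have h := classGroupPRank_add_le_one_of_dvd_card_fixed κ hκ le_rfl he0 he1 hfix m
    rwa [Nat.zero_add] at h
  exact ⟨hrank, classicalMuVanishes_and_classicalLambda_le_one_of_dvd_card_fixed κ hκ le_rfl he0 he1 hfix⟩

end Chevalley

end Literature.NumberTheory.IwasawaTheory

end
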